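import Literature.AlgebraicGeometry.HodgeTheory.VHSDataMorphismLocusHom
import Literature.AlgebraicGeometry.HodgeTheory.VHSDataSimultaneousDeterminationLocus
import Literature.AlgebraicGeometry.HodgeTheory.VHSDataHodgeLocusOverCompactCurve
import HarnessLib

/-!
# The MORPHISM LOCUS of one lattice map, and of a FINITE COLLECTION of lattice maps («extra endomorphism structure»), from bundled flat charts
# of `D₁`, `D₂` alone: everything or finite over a one-dimensional base (Cattani–Deligne–Kaplan, Cor. 1.3 for `Hom(D₁, D₂)`)

Topic `Literature/AlgebraicGeometry/HodgeTheory` (namespace `Literature.AlgebraicGeometry.Motives.VHSData.IsLocallyFlatCharted`), lane `lit-hodgefound`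
(seat `p08`, rows g59-#20, g59-#22 (§3)); sequel of `VHSDataMorphismLocusHom` (the morphism locus of `f : V₁,ℤ,s₀ → V₂,ℤ,s₀` is the determination locus of
`homClass f` in `Hom(D₁, D₂)`; everything-or-finite from LOOSE chart hypotheses ON `Hom(D₁, D₂)`), `VHSDataLocallyFlatCharted` (`IsLocallyFlatCharted.hom`:
flat charts of `D₁`, `D₂` give those of `Hom(D₁, D₂)`), `VHSDataSimultaneousDeterminationLocus` (finite collections), `VHSDataHodgeLocusOverCompactCurve`
(compact base).  THEOREMS ONLY — no definition, no named fact, no instance (D-0026 net debt `0`).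

PRINTED SOURCES, VERBATIM.  E. Cattani, P. Deligne, A. Kaplan, *On the locus of Hodge classes*, J. AMS 8 (1995), p. 484: «**Corollary 1.3.** … The set
of points in `S` where some determination of `u` is of type `(0,0)`, is an algebraic subvariety of `S`.»; «Theorem 1.1 can be applied to the variation
`Hom(𝒱, 𝒲)`: the locus where some flat determination of a given `f : 𝒱_{ℤ,s} → 𝒲_{ℤ,s}` is a morphism of Hodge structures is algebraic» (remark after
Cor. 1.4, paraphrased in the tree's `VHSDataMorphismLocusHom`); P. Deligne, *Théorie de Hodge II*, 1.1.6, 2.1 (morphisms of Hodge structures = rational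
classes of type `(0,0)` in `Hom`).  B. Moonen, F. Oort, arXiv:1112.0933 p. 9, §3 Def. 4 ∕ Rem. 5 (finite collections of Hodge tensors; «no loss of
generality to consider only a finite collection … the common stabilizer»).

* §1 ONE LATTICE MAP: **`IsLocallyFlatCharted.morphismLocus_eq_univ_or_finite`** — for `D₁`, `D₂` of the same weight, BOTH locally flat-charted by the
  same discs and ends (open ends, compact core, continuous ends), the set of `t` such that for SOME `γ : s₀ ⇝ t` the flat continuation
  `γ_* ∘ f ∘ γ_*⁻¹` rationalises to a morphism of Hodge structures `V₁,t → V₂,t` is ALL of `S` or FINITE; `…_of_compactification`, `…_of_compactSpace`,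
  `…_eq_univ_of_infinite`.
* §2 A FINITE COLLECTION `f_m` (`m ∈ ι'` finite; e.g. generators of an order acting by extra endomorphisms, `D₁ = D₂`), ONE path class for all:
  **`IsLocallyFlatCharted.setOf_exists_forall_morphism_eq_univ_or_finite`**, `…_of_compactification`, `…_of_compactSpace`.

* §3 (appended, row g59-#22) THEOREM 1.1 FOR `Hom(D₁, D₂)` IN TERMS OF MORPHISMS («isogeny-type ∕ extra-morphism locus of bounded norm»), from
  bundled charts of `D₁`, `D₂` (not necessarily flat): **`IsLocallyCharted.setOf_exists_hodgeMorphism_normLe_eq_univ_or_finite`** — the set of `t`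
  carrying a NONZERO lattice map `f : V₁,ℤ,t → V₂,ℤ,t` whose rationalisation is a morphism of Hodge structures and whose class in `Hom` has
  self-intersection `≤ K` is ALL of `S` or FINITE (it is `hodgeLocusOfNormLe (Hom(D₁,D₂)) 0 K`: every integral class of `Hom` is a `homClass f`);
  `…_of_compactification`, `…_of_compactSpace`.

HONEST SCOPE: `dim S = 1`; the flat charts of `D₁`, `D₂` are hypotheses; «morphism of Hodge structures» is delivered as «maps each `F^q` into `F^q`»
for the rationalised map (the tree's `isHodgeAt_homClass_iff`).

## References

* [CattaniDeligneKaplan1995] E. Cattani, P. Deligne, A. Kaplan, *On the locus of Hodge classes*, J. Amer. Math. Soc. 8 (1995) 483–506: Cor. 1.3 and the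
  remark after Cor. 1.4 (p. 484), «Proof of 1.5 ⟹ 1.1» (p. 485), 2.3 (p. 487).
* [DeligneHodgeII1971] P. Deligne, *Théorie de Hodge II*, Publ. Math. IHÉS 40 (1971): 1.1.6, 2.1.
* [MoonenOort2013Torelli] B. Moonen, F. Oort, *The Torelli locus and special subvarieties*, Handbook of Moduli II (2013), §3 Def. 4, Rem. 5 (arXiv p. 9).
* [KlinglerOtwinowskaUrbanik2023] B. Klingler, A. Otwinowska, D. Urbanik, *On the fields of definition of Hodge loci*, Ann. Sci. ÉNS (2023), §1.1 (cite only).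
-/

noncomputable section

open scoped TensorProduct
open _root_.Topology _root_.Filter Set

namespace Literature.AlgebraicGeometry

open Motives HodgeTheory Topology

namespace Motives.VHSData

variable {S : Type} [TopologicalSpace S] {k : ℤ} {D₁ D₂ : VHSData S k} {ι' : Type*}
variable {α ι : Type*} {ψ : α → OpenPartialHomeomorph S ℂ} {σ : ι → ℂ → S}
variable {X : Type*} [TopologicalSpace X] [CompactSpace X]

namespace IsLocallyFlatCharted

/-! ## §1 One lattice map -/

/-- **CDK COR. 1.3 FOR THE MORPHISM LOCUS OF A LATTICE MAP, FROM FLAT CHARTS OF `D₁`, `D₂`**: `S` preconnected, covered by the discs `ψ a`; `D₁`, `D₂`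
of the same weight, both locally flat-charted by `ψ`, `σ`; open ends, compact core, continuous ends; `f : V₁,ℤ,s₀ → V₂,ℤ,s₀`.  Then **the set of `t ∈ S`
such that for SOME `γ : s₀ ⇝ t` the flat continuation `γ_* ∘ f ∘ γ_*⁻¹`, rationalised, maps each `F^q V₁,t` into `F^q V₂,t` (a morphism of Hodge
structures) is ALL of `S` or FINITE** — it is the determination locus of `homClass f` in `Hom(D₁, D₂)` (weight `k − k`, level `0`), locally flat-charted
by `IsLocallyFlatCharted.hom`. [cite: CattaniDeligneKaplan1995, Cor. 1.3 and the remark after Cor. 1.4 (p. 484)] [cite: DeligneHodgeII1971, 1.1.6 and 2.1] -/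
theorem morphismLocus_eq_univ_or_finite [PreconnectedSpace S] (h₁ : D₁.IsLocallyFlatCharted ψ σ) (h₂ : D₂.IsLocallyFlatCharted ψ σ) {s₀ : S}
    (f : D₁.VZ.fiber s₀ →ₗ[ℤ] D₂.VZ.fiber s₀) (hcov : ∀ x : S, ∃ a, x ∈ (ψ a).source) (A : ι → ℝ)
    (hopen : ∀ (i : ι) (A' : ℝ), A i ≤ A' → IsOpen (σ i '' {z : ℂ | A' < z.im}))
    (hcore : ∀ A' : ι → ℝ, (∀ i, A i ≤ A' i) → ∃ K₀ : Set S, IsCompact K₀ ∧ K₀ ∪ ⋃ i, σ i '' {z : ℂ | A' i < z.im} = univ)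
    (hcont : ∀ i, ContinuousOn (σ i) {z : ℂ | A i < z.im}) :
    {t : S | ∃ γ : Path.Homotopic.Quotient s₀ t, ∀ q : ℤ,
        ((D₁.hodge t).F q).map ((D₁.homRat D₂ t (D₂.VZ.transport γ ∘ₗ f ∘ₗ D₁.VZ.transport γ.symm)).baseChange ℂ) ≤ (D₂.hodge t).F q} = univ ∨
      {t : S | ∃ γ : Path.Homotopic.Quotient s₀ t, ∀ q : ℤ,
        ((D₁.hodge t).F q).map ((D₁.homRat D₂ t (D₂.VZ.transport γ ∘ₗ f ∘ₗ D₁.VZ.transport γ.symm)).baseChange ℂ) ≤ (D₂.hodge t).F q}.Finite := by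
  rw [D₁.morphismLocus_eq_determinationLocus_homClass D₂ s₀ f]
  exact (h₁.hom h₂).determinationLocus_eq_univ_or_finite (p := 0) (by simp) _ hcov A hopen hcore hcont

/-- **The same over a PUNCTURED COMPACT CURVE** (ends, core and continuity of the ends from a compactification with disc charts at the punctures).
[cite: CattaniDeligneKaplan1995, Cor. 1.3 (p. 484), 2.3 (p. 487)] [cite: DeligneHodgeII1971, 1.1.6 and 2.1] -/
theorem morphismLocus_eq_univ_or_finite_of_compactification [PreconnectedSpace S] (h₁ : D₁.IsLocallyFlatCharted ψ σ)
    (h₂ : D₂.IsLocallyFlatCharted ψ σ) {s₀ : S} (f : D₁.VZ.fiber s₀ →ₗ[ℤ] D₂.VZ.fiber s₀) (hcov : ∀ x : S, ∃ a, x ∈ (ψ a).source) (A : ι → ℝ)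
    {j : S → X} (hj : IsEmbedding j) (pt : ι → X) (hpS : ∀ i, pt i ∉ range j) (hcovX : ∀ x : X, x ∉ range j → ∃ i, x = pt i)
    (φ : ι → OpenPartialHomeomorph X ℂ) (hp : ∀ i, pt i ∈ (φ i).source) (hφp : ∀ i, φ i (pt i) = 0)
    (hball : ∀ i, Metric.ball (0 : ℂ) (Real.exp (-(2 * Real.pi * A i))) ⊆ (φ i).target)
    (hσ : ∀ (i : ι) (z : ℂ), A i < z.im → j (σ i z) = (φ i).symm (Complex.exp (2 * Real.pi * Complex.I * z))) :
    {t : S | ∃ γ : Path.Homotopic.Quotient s₀ t, ∀ q : ℤ,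
        ((D₁.hodge t).F q).map ((D₁.homRat D₂ t (D₂.VZ.transport γ ∘ₗ f ∘ₗ D₁.VZ.transport γ.symm)).baseChange ℂ) ≤ (D₂.hodge t).F q} = univ ∨
      {t : S | ∃ γ : Path.Homotopic.Quotient s₀ t, ∀ q : ℤ,
        ((D₁.hodge t).F q).map ((D₁.homRat D₂ t (D₂.VZ.transport γ ∘ₗ f ∘ₗ D₁.VZ.transport γ.symm)).baseChange ℂ) ≤ (D₂.hodge t).F q}.Finite :=
  morphismLocus_eq_univ_or_finite h₁ h₂ f hcov A (Topology.isOpen_image_ends hj φ A hball σ hσ)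
    (Topology.exists_isCompact_core hj pt hpS hcovX φ hp hφp A hball σ hσ) (continuousOn_end_lifts hj φ A hball σ hσ)

/-- **The same over a COMPACT base** (no ends). [cite: CattaniDeligneKaplan1995, Cor. 1.3 (p. 484)] [cite: DeligneHodgeII1971, 1.1.6 and 2.1] -/
theorem morphismLocus_eq_univ_or_finite_of_compactSpace [CompactSpace S] [PreconnectedSpace S] [IsEmpty ι] (h₁ : D₁.IsLocallyFlatCharted ψ σ)
    (h₂ : D₂.IsLocallyFlatCharted ψ σ) {s₀ : S} (f : D₁.VZ.fiber s₀ →ₗ[ℤ] D₂.VZ.fiber s₀) (hcov : ∀ x : S, ∃ a, x ∈ (ψ a).source) :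
    {t : S | ∃ γ : Path.Homotopic.Quotient s₀ t, ∀ q : ℤ,
        ((D₁.hodge t).F q).map ((D₁.homRat D₂ t (D₂.VZ.transport γ ∘ₗ f ∘ₗ D₁.VZ.transport γ.symm)).baseChange ℂ) ≤ (D₂.hodge t).F q} = univ ∨
      {t : S | ∃ γ : Path.Homotopic.Quotient s₀ t, ∀ q : ℤ,
        ((D₁.hodge t).F q).map ((D₁.homRat D₂ t (D₂.VZ.transport γ ∘ₗ f ∘ₗ D₁.VZ.transport γ.symm)).baseChange ℂ) ≤ (D₂.hodge t).F q}.Finite :=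
  morphismLocus_eq_univ_or_finite h₁ h₂ f hcov (fun i => isEmptyElim i) (fun i => isEmptyElim i)
    (fun A' _ => exists_isCompact_core_of_compactSpace A') fun i => isEmptyElim i

/-- **Identity-principle form**: if for INFINITELY many `t` some flat continuation of `f` is a morphism of Hodge structures `V₁,t → V₂,t`, then this
holds at EVERY `t`. [cite: CattaniDeligneKaplan1995, Cor. 1.3 (p. 484)] -/
theorem morphismLocus_eq_univ_of_infinite [PreconnectedSpace S] (h₁ : D₁.IsLocallyFlatCharted ψ σ) (h₂ : D₂.IsLocallyFlatCharted ψ σ) {s₀ : S}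
    (f : D₁.VZ.fiber s₀ →ₗ[ℤ] D₂.VZ.fiber s₀)
    (hinf : {t : S | ∃ γ : Path.Homotopic.Quotient s₀ t, ∀ q : ℤ,
        ((D₁.hodge t).F q).map ((D₁.homRat D₂ t (D₂.VZ.transport γ ∘ₗ f ∘ₗ D₁.VZ.transport γ.symm)).baseChange ℂ) ≤ (D₂.hodge t).F q}.Infinite)
    (hcov : ∀ x : S, ∃ a, x ∈ (ψ a).source) (A : ι → ℝ) (hopen : ∀ (i : ι) (A' : ℝ), A i ≤ A' → IsOpen (σ i '' {z : ℂ | A' < z.im}))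
    (hcore : ∀ A' : ι → ℝ, (∀ i, A i ≤ A' i) → ∃ K₀ : Set S, IsCompact K₀ ∧ K₀ ∪ ⋃ i, σ i '' {z : ℂ | A' i < z.im} = univ)
    (hcont : ∀ i, ContinuousOn (σ i) {z : ℂ | A i < z.im}) :
    {t : S | ∃ γ : Path.Homotopic.Quotient s₀ t, ∀ q : ℤ,
        ((D₁.hodge t).F q).map ((D₁.homRat D₂ t (D₂.VZ.transport γ ∘ₗ f ∘ₗ D₁.VZ.transport γ.symm)).baseChange ℂ) ≤ (D₂.hodge t).F q} = univ :=
  (morphismLocus_eq_univ_or_finite h₁ h₂ f hcov A hopen hcore hcont).resolve_right hinf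

/-! ## §2 A finite collection of lattice maps, one path class for all («extra endomorphism structure») -/

/-- **THE LOCUS OF A FINITE COLLECTION OF LATTICE MAPS `f_m : V₁,ℤ,s₀ → V₂,ℤ,s₀` BECOMING MORPHISMS OF HODGE STRUCTURES ALONG ONE PATH CLASS is ALL of
`S` or FINITE** (e.g. `D₁ = D₂` and the `f_m` generators of a ring of prospective extra endomorphisms: «no loss of generality to consider only a finite
collection … the common stabilizer»): from flat charts of `D₁`, `D₂` alone — it is the simultaneous determination locus of the classes `homClass f_m` in
the constant family `Hom(D₁, D₂)`. [cite: CattaniDeligneKaplan1995, Cor. 1.3 and the remark after Cor. 1.4 (p. 484)] [cite: DeligneHodgeII1971, 1.1.6 and 2.1]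
[cite: MoonenOort2013Torelli, §3 Def. 4 and Rem. 5 (arXiv p. 9)] -/
theorem setOf_exists_forall_morphism_eq_univ_or_finite [PreconnectedSpace S] [Finite ι'] (h₁ : D₁.IsLocallyFlatCharted ψ σ)
    (h₂ : D₂.IsLocallyFlatCharted ψ σ) {s₀ : S} (f : ι' → (D₁.VZ.fiber s₀ →ₗ[ℤ] D₂.VZ.fiber s₀)) (hcov : ∀ x : S, ∃ a, x ∈ (ψ a).source)
    (A : ι → ℝ) (hopen : ∀ (i : ι) (A' : ℝ), A i ≤ A' → IsOpen (σ i '' {z : ℂ | A' < z.im}))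
    (hcore : ∀ A' : ι → ℝ, (∀ i, A i ≤ A' i) → ∃ K₀ : Set S, IsCompact K₀ ∧ K₀ ∪ ⋃ i, σ i '' {z : ℂ | A' i < z.im} = univ)
    (hcont : ∀ i, ContinuousOn (σ i) {z : ℂ | A i < z.im}) :
    {t : S | ∃ γ : Path.Homotopic.Quotient s₀ t, ∀ m, ∀ q : ℤ,
        ((D₁.hodge t).F q).map ((D₁.homRat D₂ t (D₂.VZ.transport γ ∘ₗ f m ∘ₗ D₁.VZ.transport γ.symm)).baseChange ℂ) ≤ (D₂.hodge t).F q} = univ ∨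
      {t : S | ∃ γ : Path.Homotopic.Quotient s₀ t, ∀ m, ∀ q : ℤ,
        ((D₁.hodge t).F q).map ((D₁.homRat D₂ t (D₂.VZ.transport γ ∘ₗ f m ∘ₗ D₁.VZ.transport γ.symm)).baseChange ℂ) ≤ (D₂.hodge t).F q}.Finite := by
  have heq : {t : S | ∃ γ : Path.Homotopic.Quotient s₀ t, ∀ m, ∀ q : ℤ,
      ((D₁.hodge t).F q).map ((D₁.homRat D₂ t (D₂.VZ.transport γ ∘ₗ f m ∘ₗ D₁.VZ.transport γ.symm)).baseChange ℂ) ≤ (D₂.hodge t).F q} =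
      {t : S | ∃ γ : Path.Homotopic.Quotient s₀ t,
        ∀ m, (D₁.hom D₂).IsHodgeAt t 0 ((D₁.hom D₂).VZ.transport γ (D₁.homClass D₂ s₀ (f m)))} := by
    ext t
    simp only [mem_setOf_eq, hom_VZ_transport_homClass, isHodgeAt_homClass_iff]
  rw [heq]
  exact simultaneousDeterminationLocus_eq_univ_or_finite (D := fun _ : ι' => D₁.hom D₂) (p := fun _ => 0) (fun _ => h₁.hom h₂)
    (fun _ => by simp) _ hcov A hopen hcore hcont

/-- **The same over a PUNCTURED COMPACT CURVE.** [cite: CattaniDeligneKaplan1995, Cor. 1.3 (p. 484), 2.3 (p. 487)]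
[cite: MoonenOort2013Torelli, §3 Def. 4 and Rem. 5 (arXiv p. 9)] -/
theorem setOf_exists_forall_morphism_eq_univ_or_finite_of_compactification [PreconnectedSpace S] [Finite ι'] (h₁ : D₁.IsLocallyFlatCharted ψ σ)
    (h₂ : D₂.IsLocallyFlatCharted ψ σ) {s₀ : S} (f : ι' → (D₁.VZ.fiber s₀ →ₗ[ℤ] D₂.VZ.fiber s₀)) (hcov : ∀ x : S, ∃ a, x ∈ (ψ a).source)
    (A : ι → ℝ) {j : S → X} (hj : IsEmbedding j) (pt : ι → X) (hpS : ∀ i, pt i ∉ range j) (hcovX : ∀ x : X, x ∉ range j → ∃ i, x = pt i)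
    (φ : ι → OpenPartialHomeomorph X ℂ) (hp : ∀ i, pt i ∈ (φ i).source) (hφp : ∀ i, φ i (pt i) = 0)
    (hball : ∀ i, Metric.ball (0 : ℂ) (Real.exp (-(2 * Real.pi * A i))) ⊆ (φ i).target)
    (hσ : ∀ (i : ι) (z : ℂ), A i < z.im → j (σ i z) = (φ i).symm (Complex.exp (2 * Real.pi * Complex.I * z))) :
    {t : S | ∃ γ : Path.Homotopic.Quotient s₀ t, ∀ m, ∀ q : ℤ,
        ((D₁.hodge t).F q).map ((D₁.homRat D₂ t (D₂.VZ.transport γ ∘ₗ f m ∘ₗ D₁.VZ.transport γ.symm)).baseChange ℂ) ≤ (D₂.hodge t).F q} = univ ∨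
      {t : S | ∃ γ : Path.Homotopic.Quotient s₀ t, ∀ m, ∀ q : ℤ,
        ((D₁.hodge t).F q).map ((D₁.homRat D₂ t (D₂.VZ.transport γ ∘ₗ f m ∘ₗ D₁.VZ.transport γ.symm)).baseChange ℂ) ≤ (D₂.hodge t).F q}.Finite :=
  setOf_exists_forall_morphism_eq_univ_or_finite h₁ h₂ f hcov A (Topology.isOpen_image_ends hj φ A hball σ hσ)
    (Topology.exists_isCompact_core hj pt hpS hcovX φ hp hφp A hball σ hσ) (continuousOn_end_lifts hj φ A hball σ hσ)

/-- **The same over a COMPACT base** (no ends). [cite: CattaniDeligneKaplan1995, Cor. 1.3 (p. 484)] [cite: MoonenOort2013Torelli, §3 Def. 4 and Rem. 5 (arXiv p. 9)] -/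
theorem setOf_exists_forall_morphism_eq_univ_or_finite_of_compactSpace [CompactSpace S] [PreconnectedSpace S] [IsEmpty ι] [Finite ι']
    (h₁ : D₁.IsLocallyFlatCharted ψ σ) (h₂ : D₂.IsLocallyFlatCharted ψ σ) {s₀ : S} (f : ι' → (D₁.VZ.fiber s₀ →ₗ[ℤ] D₂.VZ.fiber s₀))
    (hcov : ∀ x : S, ∃ a, x ∈ (ψ a).source) :
    {t : S | ∃ γ : Path.Homotopic.Quotient s₀ t, ∀ m, ∀ q : ℤ,
        ((D₁.hodge t).F q).map ((D₁.homRat D₂ t (D₂.VZ.transport γ ∘ₗ f m ∘ₗ D₁.VZ.transport γ.symm)).baseChange ℂ) ≤ (D₂.hodge t).F q} = univ ∨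
      {t : S | ∃ γ : Path.Homotopic.Quotient s₀ t, ∀ m, ∀ q : ℤ,
        ((D₁.hodge t).F q).map ((D₁.homRat D₂ t (D₂.VZ.transport γ ∘ₗ f m ∘ₗ D₁.VZ.transport γ.symm)).baseChange ℂ) ≤ (D₂.hodge t).F q}.Finite :=
  setOf_exists_forall_morphism_eq_univ_or_finite h₁ h₂ f hcov (fun i => isEmptyElim i) (fun i => isEmptyElim i)
    (fun A' _ => exists_isCompact_core_of_compactSpace A') fun i => isEmptyElim i

end IsLocallyFlatCharted


/-! ## §3 Theorem 1.1 for `Hom(D₁, D₂)` in terms of morphisms: the extra-morphism locus of bounded norm -/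

omit [CompactSpace X] in
/-- **Every integral class of `Hom(D₁, D₂)` at `t` is the class of a lattice map, and the dictionary is exact**: the set of `t ∈ S` carrying a NONZERO
`ℤ`-linear `f : V₁,ℤ,t → V₂,ℤ,t` whose rationalisation maps each `F^q V₁,t` into `F^q V₂,t` and whose class `homClass f` has self-intersection `≤ K`
for the induced form of `Hom(D₁, D₂)` IS the Hodge locus `hodgeLocusOfNormLe (Hom(D₁, D₂)) 0 K`. [cite: DeligneHodgeII1971, 1.1.6 and 2.1]
[cite: CattaniDeligneKaplan1995, §1 (p. 484)] -/
theorem setOf_exists_hodgeMorphism_normLe_eq_hodgeLocusOfNormLe_hom (D₁ D₂ : VHSData S k) (K : ℤ) :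
    {t : S | ∃ f : D₁.VZ.fiber t →ₗ[ℤ] D₂.VZ.fiber t, f ≠ 0 ∧
        (∀ q : ℤ, ((D₁.hodge t).F q).map ((D₁.homRat D₂ t f).baseChange ℂ) ≤ (D₂.hodge t).F q) ∧
        ((D₁.hom D₂).form t).form ((D₁.hom D₂).toRat t (D₁.homClass D₂ t f)) ((D₁.hom D₂).toRat t (D₁.homClass D₂ t f)) ≤ (K : ℚ)} =
      (D₁.hom D₂).hodgeLocusOfNormLe 0 K := by
  ext t
  simp only [mem_setOf_eq, mem_hodgeLocusOfNormLe_iff]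
  haveI : Module.Free ℤ (D₁.VZ.fiber t) := D₁.free t
  haveI : Module.Finite ℤ (D₁.VZ.fiber t) := D₁.finite t
  constructor
  · rintro ⟨f, hf0, hF, hQ⟩
    refine ⟨D₁.homClass D₂ t f, fun h0 => hf0 ?_, (D₁.isHodgeAt_homClass_iff D₂ t f).mpr hF, hQ⟩
    rw [← D₁.dualTensorHom_homClass D₂ t f, h0]
    exact map_zero (dualTensorHom ℤ (D₁.VZ.fiber t) (D₂.VZ.fiber t))
  · rintro ⟨u, hu0, hH, hQ⟩
    -- every class of `Hom(D₁, D₂)_ℤ,t = V₁,ℤ,t^∨ ⊗ V₂,ℤ,t` is `homClass` of its contraction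
    have hf : D₁.homClass D₂ t (dualTensorHom ℤ (D₁.VZ.fiber t) (D₂.VZ.fiber t)
        (u : Module.Dual ℤ (D₁.VZ.fiber t) ⊗[ℤ] D₂.VZ.fiber t)) = u := by
      show (dualTensorHomEquiv ℤ (D₁.VZ.fiber t) (D₂.VZ.fiber t)).symm _ = u
      rw [LinearEquiv.symm_apply_eq, dualTensorHomEquiv, dualTensorHomEquivOfBasis_apply]
    refine ⟨dualTensorHom ℤ (D₁.VZ.fiber t) (D₂.VZ.fiber t) (u : Module.Dual ℤ (D₁.VZ.fiber t) ⊗[ℤ] D₂.VZ.fiber t), fun h0 => hu0 ?_,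
      (D₁.isHodgeAt_homClass_iff D₂ t _).mp (by rwa [hf]), by rwa [hf]⟩
    rw [← hf, h0]
    show (dualTensorHomEquiv ℤ (D₁.VZ.fiber t) (D₂.VZ.fiber t)).symm 0 = 0
    exact map_zero _

namespace IsLocallyCharted

/-- **THEOREM 1.1 FOR `Hom(D₁, D₂)`, IN TERMS OF MORPHISMS, FROM BUNDLED CHARTS OF `D₁`, `D₂`** («the extra-morphism ∕ isogeny-type locus of bounded
norm»): `S` preconnected, covered by the discs; `D₁`, `D₂` of the same weight, both locally charted by `ψ`, `σ` (flatness NOT needed); open ends,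
compact core.  Then **the set of `t ∈ S` carrying a NONZERO lattice map `f : V₁,ℤ,t → V₂,ℤ,t` that rationalises to a morphism of Hodge structures
and whose class has self-intersection `≤ K` is ALL of `S` or FINITE** — Theorem 1.1 for the locally charted `Hom(D₁, D₂)` (`IsLocallyCharted.hom`).
[cite: CattaniDeligneKaplan1995, §1, Thm. 1.1 and the remark after Cor. 1.4 (p. 484)] [cite: DeligneHodgeII1971, 1.1.6 and 2.1] -/
theorem setOf_exists_hodgeMorphism_normLe_eq_univ_or_finite [PreconnectedSpace S] (h₁ : D₁.IsLocallyCharted ψ σ) (h₂ : D₂.IsLocallyCharted ψ σ)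
    (K : ℤ) (hcov : ∀ x : S, ∃ a, x ∈ (ψ a).source) (A : ι → ℝ) (hopen : ∀ (i : ι) (A' : ℝ), A i ≤ A' → IsOpen (σ i '' {z : ℂ | A' < z.im}))
    (hcore : ∀ A' : ι → ℝ, (∀ i, A i ≤ A' i) → ∃ K₀ : Set S, IsCompact K₀ ∧ K₀ ∪ ⋃ i, σ i '' {z : ℂ | A' i < z.im} = univ) :
    {t : S | ∃ f : D₁.VZ.fiber t →ₗ[ℤ] D₂.VZ.fiber t, f ≠ 0 ∧
        (∀ q : ℤ, ((D₁.hodge t).F q).map ((D₁.homRat D₂ t f).baseChange ℂ) ≤ (D₂.hodge t).F q) ∧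
        ((D₁.hom D₂).form t).form ((D₁.hom D₂).toRat t (D₁.homClass D₂ t f)) ((D₁.hom D₂).toRat t (D₁.homClass D₂ t f)) ≤ (K : ℚ)} = univ ∨
      {t : S | ∃ f : D₁.VZ.fiber t →ₗ[ℤ] D₂.VZ.fiber t, f ≠ 0 ∧
        (∀ q : ℤ, ((D₁.hodge t).F q).map ((D₁.homRat D₂ t f).baseChange ℂ) ≤ (D₂.hodge t).F q) ∧
        ((D₁.hom D₂).form t).form ((D₁.hom D₂).toRat t (D₁.homClass D₂ t f)) ((D₁.hom D₂).toRat t (D₁.homClass D₂ t f)) ≤ (K : ℚ)}.Finite := by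
  rw [setOf_exists_hodgeMorphism_normLe_eq_hodgeLocusOfNormLe_hom D₁ D₂ K]
  exact (h₁.hom h₂).hodgeLocusOfNormLe_eq_univ_or_finite (p := 0) (by simp) K hcov A hopen hcore

/-- **The same over a PUNCTURED COMPACT CURVE.** [cite: CattaniDeligneKaplan1995, Thm. 1.1 (p. 484), 2.3 (p. 487)] [cite: DeligneHodgeII1971, 1.1.6 and 2.1] -/
theorem setOf_exists_hodgeMorphism_normLe_eq_univ_or_finite_of_compactification [PreconnectedSpace S] (h₁ : D₁.IsLocallyCharted ψ σ)
    (h₂ : D₂.IsLocallyCharted ψ σ) (K : ℤ) (hcov : ∀ x : S, ∃ a, x ∈ (ψ a).source) (A : ι → ℝ)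
    {j : S → X} (hj : IsEmbedding j) (pt : ι → X) (hpS : ∀ i, pt i ∉ range j) (hcovX : ∀ x : X, x ∉ range j → ∃ i, x = pt i)
    (φ : ι → OpenPartialHomeomorph X ℂ) (hp : ∀ i, pt i ∈ (φ i).source) (hφp : ∀ i, φ i (pt i) = 0)
    (hball : ∀ i, Metric.ball (0 : ℂ) (Real.exp (-(2 * Real.pi * A i))) ⊆ (φ i).target)
    (hσ : ∀ (i : ι) (z : ℂ), A i < z.im → j (σ i z) = (φ i).symm (Complex.exp (2 * Real.pi * Complex.I * z))) :
    {t : S | ∃ f : D₁.VZ.fiber t →ₗ[ℤ] D₂.VZ.fiber t, f ≠ 0 ∧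
        (∀ q : ℤ, ((D₁.hodge t).F q).map ((D₁.homRat D₂ t f).baseChange ℂ) ≤ (D₂.hodge t).F q) ∧
        ((D₁.hom D₂).form t).form ((D₁.hom D₂).toRat t (D₁.homClass D₂ t f)) ((D₁.hom D₂).toRat t (D₁.homClass D₂ t f)) ≤ (K : ℚ)} = univ ∨
      {t : S | ∃ f : D₁.VZ.fiber t →ₗ[ℤ] D₂.VZ.fiber t, f ≠ 0 ∧
        (∀ q : ℤ, ((D₁.hodge t).F q).map ((D₁.homRat D₂ t f).baseChange ℂ) ≤ (D₂.hodge t).F q) ∧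
        ((D₁.hom D₂).form t).form ((D₁.hom D₂).toRat t (D₁.homClass D₂ t f)) ((D₁.hom D₂).toRat t (D₁.homClass D₂ t f)) ≤ (K : ℚ)}.Finite :=
  setOf_exists_hodgeMorphism_normLe_eq_univ_or_finite h₁ h₂ K hcov A (Topology.isOpen_image_ends hj φ A hball σ hσ)
    (Topology.exists_isCompact_core hj pt hpS hcovX φ hp hφp A hball σ hσ)

/-- **The same over a COMPACT base** (no ends). [cite: CattaniDeligneKaplan1995, Thm. 1.1 (p. 484)] [cite: DeligneHodgeII1971, 1.1.6 and 2.1] -/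
theorem setOf_exists_hodgeMorphism_normLe_eq_univ_or_finite_of_compactSpace [CompactSpace S] [PreconnectedSpace S] [IsEmpty ι]
    (h₁ : D₁.IsLocallyCharted ψ σ) (h₂ : D₂.IsLocallyCharted ψ σ) (K : ℤ) (hcov : ∀ x : S, ∃ a, x ∈ (ψ a).source) :
    {t : S | ∃ f : D₁.VZ.fiber t →ₗ[ℤ] D₂.VZ.fiber t, f ≠ 0 ∧
        (∀ q : ℤ, ((D₁.hodge t).F q).map ((D₁.homRat D₂ t f).baseChange ℂ) ≤ (D₂.hodge t).F q) ∧
        ((D₁.hom D₂).form t).form ((D₁.hom D₂).toRat t (D₁.homClass D₂ t f)) ((D₁.hom D₂).toRat t (D₁.homClass D₂ t f)) ≤ (K : ℚ)} = univ ∨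
      {t : S | ∃ f : D₁.VZ.fiber t →ₗ[ℤ] D₂.VZ.fiber t, f ≠ 0 ∧
        (∀ q : ℤ, ((D₁.hodge t).F q).map ((D₁.homRat D₂ t f).baseChange ℂ) ≤ (D₂.hodge t).F q) ∧
        ((D₁.hom D₂).form t).form ((D₁.hom D₂).toRat t (D₁.homClass D₂ t f)) ((D₁.hom D₂).toRat t (D₁.homClass D₂ t f)) ≤ (K : ℚ)}.Finite :=
  setOf_exists_hodgeMorphism_normLe_eq_univ_or_finite h₁ h₂ K hcov (fun i => isEmptyElim i) (fun i => isEmptyElim i)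
    fun A' _ => exists_isCompact_core_of_compactSpace A'

end IsLocallyCharted

end Motives.VHSData

end Literature.AlgebraicGeometry

end
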